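import Mathlib
import Literature.NumberTheory.Transcendental.KZProduct
import Literature.NumberTheory.Transcendental.KZProductIdeal
import Literature.NumberTheory.Transcendental.KZCalculusProofs
import Literature.NumberTheory.Transcendental.KZVolumeConjectureProofs
import Literature.NumberTheory.Transcendental.SemialgebraicMapsProofs
import Summits.KontsevichZagierPeriods.KontsevichZagierPeriods.Theorems.SoloInformedPolyJacobian
import Summits.KontsevichZagierPeriods.KontsevichZagierPeriods.Theorems.SoloInformedVolumeLadder
import Summits.KontsevichZagierPeriods.KontsevichZagierPeriods.Theorems.SoloInformedPappus
import Summits.KontsevichZagierPeriods.KontsevichZagierPeriods.Theorems.SoloInformedKummerBox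
import Summits.KontsevichZagierPeriods.KontsevichZagierPeriods.Theorems.SoloInformedDilation
import HarnessLib
import HarnessLib.Audit

/-!
# SoloInformed — the Theorem II instance inside the calculus: a solid torus against the Kummer box

Both sides of the residency paper's Theorem II instance (§3, corrected s16), pinned in the four-move
calculus, and the exact shape of what volume rung `3` would assert about them.

* `soloInformedTorusRep = [T₀, 1]`, `T₀ = {(x² + y² − 2)² + z² ≤ 1} = Rev K₀`, the solid of revolution
  of `K₀ = {u ≥ 0, (u² − 2)² + z² ≤ 1}`; UNCONDITIONALLY `[T₀, 1] − [D̄]·[D̄] ∈ relations`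
  (`soloInformed_torusRep_sub_piRep_mul_piRep_mem_relations`: Pappus inside the calculus,
  `SoloInformedPappus`, plus one translation), so `vol T₀ = π²` (`soloInformed_value_torusRep`).
* `[B(2,3), 1] − [L₂]·[L₃] ∈ relations` unconditionally (`SoloInformedKummerBox`), `vol = log 2 · log 3`.
* Dilations along `z` by natural factors (`SoloInformedDilation`: `[Φ_c σ, 1] ∼ c · [σ, 1]`) realise
  rational multiples by honest solids.

**Theorem (`soloInformed_rung_three_torus_box`).** `SoloInformedVolumeRung 3` and a relation
`p · π² = q · log 2 · log 3` with `p, q ≥ 1` give `p · [D̄]·[D̄] − q · [L₂]·[L₃] ∈ relations`.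
The paper (§3, Theorem A + the period torsor of `⟨K₂ ⊕ K₃⟩`, PAPER) shows that no such relation holds
in the formal period ring; hence `Rung_3 ⇒ π² ∉ ℚ_{>0} · log 2 · log 3`, the case `(2,3)` of the weak
four-exponentials conjecture (open). This file is the KERNEL part of that reduction.

Residency `solo-KontsevichZagierPeriods-informed` (PLAN.md, session s16).
References: M. Kontsevich, D. Zagier, *Periods* (2001), §1.1–§1.2.
-/

noncomputable section

open MeasureTheory Set Filter
open scoped Topology

namespace Summit.KontsevichZagierPeriods.KontsevichZagierPeriods.Theorems

open Literature.NumberTheory.Transcendental Literature.NumberTheory.Transcendental.KZ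
open Literature.ModelTheory.ExponentialFields (IsSemialgebraic isSemialgebraic_setOf_eval_le
  isSemialgebraic_setOf_eval_lt)

/-! ### The solid torus `T₀ = {(x² + y² − 2)² + z² ≤ 1}` -/

/-- The meridian section `K₀ = {u ≥ 0, (u² − 2)² + z² ≤ 1}`. -/
def soloInformedTorusSectionDom : Set (Fin 2 → ℝ) :=
  {y | 0 ≤ y 0 ∧ (y 0 ^ 2 - 2) ^ 2 + y 1 ^ 2 ≤ 1}

/-- `K₀` is `ℚ`-semialgebraic. -/
theorem isSemialgebraic_soloInformedTorusSectionDom : IsSemialgebraic ℚ soloInformedTorusSectionDom := by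
  have h1 := isSemialgebraic_setOf_eval_le (k := ℚ) (R := ℝ) (0 : MvPolynomial (Fin 2) ℚ)
    (MvPolynomial.X 0)
  have h2 := isSemialgebraic_setOf_eval_le (k := ℚ) (R := ℝ)
    ((MvPolynomial.X 0 ^ 2 - 2) ^ 2 + MvPolynomial.X 1 ^ 2 : MvPolynomial (Fin 2) ℚ) 1
  simp only [map_zero, map_one, map_add, map_sub, map_pow, map_ofNat, MvPolynomial.aeval_X] at h1 h2
  exact h1.inter h2

/-- Bounds on `K₀`. -/
theorem soloInformed_torusSection_bounds {y : Fin 2 → ℝ} (hy : y ∈ soloInformedTorusSectionDom) :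
    (-2 ≤ y 0 ∧ y 0 ≤ 2) ∧ (-2 ≤ y 1 ∧ y 1 ≤ 2) := by
  obtain ⟨h0, h⟩ := hy
  have h3 : y 0 ^ 2 ≤ 3 := by nlinarith [sq_nonneg (y 1), sq_nonneg (y 0 ^ 2 - 3)]
  refine ⟨⟨by linarith, by nlinarith⟩, ⟨by nlinarith [sq_nonneg (y 0 ^ 2 - 2)],
    by nlinarith [sq_nonneg (y 0 ^ 2 - 2)]⟩⟩

/-- `K₀` is compact. -/
theorem isCompact_soloInformedTorusSectionDom : IsCompact soloInformedTorusSectionDom := by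
  refine Metric.isCompact_of_isClosed_isBounded ?_
    ((Metric.isBounded_Icc (fun _ : Fin 2 => (-2 : ℝ)) (fun _ => (2 : ℝ))).subset ?_)
  · exact (isClosed_le continuous_const (continuous_apply 0)).inter
      (isClosed_le (((((continuous_apply 0).pow 2).sub continuous_const).pow 2).add
        ((continuous_apply 1).pow 2)) continuous_const)
  · intro y hy
    have hb := soloInformed_torusSection_bounds hy
    refine ⟨fun i => ?_, fun i => ?_⟩ <;> fin_cases i
    exacts [hb.1.1, hb.2.1, hb.1.2, hb.2.2]

/-- The section `[K₀, 1]` as a planar representation. -/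
def soloInformedTorusSection : IntegralRep 2 where
  domain := soloInformedTorusSectionDom
  integrand _ := 1
  isSemialgebraic_domain := isSemialgebraic_soloInformedTorusSectionDom
  isSemialgebraicFunOn_integrand := by
    simpa using isSemialgebraicFunOn_ratCast isSemialgebraic_soloInformedTorusSectionDom 1
  integrableOn :=
    continuous_const.continuousOn.integrableOn_compact isCompact_soloInformedTorusSectionDom

/-- `K₀ ⊆ {u ≥ 0}`. -/
theorem soloInformedTorusSection_subset : soloInformedTorusSection.domain ⊆ {y | 0 ≤ y 0} :=
  fun _ hy => hy.1

/-- **The solid torus** `[T₀, 1] = [Rev K₀, 1]`. -/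
def soloInformedTorusRep : IntegralRep 3 :=
  soloInformedRevRep soloInformedTorusSection isCompact_soloInformedTorusSectionDom

/-- `T₀ = {(x² + y² − 2)² + z² ≤ 1}`. -/
theorem soloInformed_mem_torusRep (x : Fin 3 → ℝ) :
    x ∈ soloInformedTorusRep.domain ↔ (x 0 ^ 2 + x 1 ^ 2 - 2) ^ 2 + x 2 ^ 2 ≤ 1 := by
  have h0 : 0 ≤ x 0 ^ 2 + x 1 ^ 2 := by positivity
  simp [soloInformedTorusRep, soloInformedTorusSection, soloInformedTorusSectionDom,
    Real.sq_sqrt h0, Real.sqrt_nonneg]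

/-- `T₀` is compact. -/
theorem isCompact_soloInformedTorusRep_domain : IsCompact soloInformedTorusRep.domain := by
  obtain ⟨R, hR⟩ := isCompact_soloInformedTorusSectionDom.isBounded.exists_norm_le
  exact (isCompact_closedBall (0 : Fin 3 → ℝ) R).of_isClosed_subset
    (isCompact_soloInformedTorusSectionDom.isClosed.preimage soloInformed_continuous_profile)
    (soloInformedRev_subset_closedBall hR)

/-- `T₀` has non-empty interior (it contains a neighbourhood of `(1, 1, 0)`). -/
theorem soloInformed_interior_torusRep_nonempty : (interior soloInformedTorusRep.domain).Nonempty := by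
  refine ⟨![1, 1, 0], mem_interior.2 ⟨{x | (x 0 ^ 2 + x 1 ^ 2 - 2) ^ 2 + x 2 ^ 2 < 1},
    fun x hx => (soloInformed_mem_torusRep x).2 (le_of_lt hx), ?_, ?_⟩⟩
  · exact isOpen_lt ((((((continuous_apply 0).pow 2).add ((continuous_apply 1).pow 2)).sub
      continuous_const).pow 2).add ((continuous_apply 2).pow 2)) continuous_const
  · show (((1 : ℝ) ^ 2 + 1 ^ 2 - 2) ^ 2 + 0 ^ 2 < 1)
    norm_num

/-! ### `Λ K₀` is a translate of the unit disc -/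

/-- The translation `τ(s, z) = (s − 2, z)` as polynomials. -/
def soloInformedDiscShiftPoly : Fin 2 → MvPolynomial (Fin 2) ℚ :=
  ![MvPolynomial.X 0 - MvPolynomial.C 2, MvPolynomial.X 1]

/-- The translation `τ(s, z) = (s − 2, z)`. -/
def soloInformedDiscShift : (Fin 2 → ℝ) → (Fin 2 → ℝ) := soloInformedPolyMap soloInformedDiscShiftPoly

/-- Components of `τ`. -/
@[simp] theorem soloInformedDiscShift_apply_zero (w : Fin 2 → ℝ) : soloInformedDiscShift w 0 = w 0 - 2 := by
  simp [soloInformedDiscShift, soloInformedDiscShiftPoly]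

/-- Components of `τ`. -/
@[simp] theorem soloInformedDiscShift_apply_one (w : Fin 2 → ℝ) : soloInformedDiscShift w 1 = w 1 := by
  simp [soloInformedDiscShift, soloInformedDiscShiftPoly]

/-- `det τ' = 1`. -/
theorem soloInformed_det_discShift (w : Fin 2 → ℝ) : (soloInformedJacCLM soloInformedDiscShiftPoly w).det = 1 := by
  rw [soloInformed_det_jacCLM, Matrix.det_fin_two]
  simp [soloInformedJacMat_apply, soloInformedDiscShiftPoly]

/-- `Λ K₀ = {(s − 2)² + z² ≤ 1}` and `τ(Λ K₀) = D̄`: the domain equation of rule (2). -/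
theorem soloInformed_piDisc_eq_shift_image :
    piRep.domain = soloInformedDiscShift ''
      (soloInformedFlatRep soloInformedTorusSection isCompact_soloInformedTorusSectionDom).domain := by
  rw [soloInformedFlatRep_domain, piRep_domain]
  ext v
  constructor
  · intro hv
    rw [mem_piDisc] at hv
    have h0 : 0 ≤ v 0 + 2 := by nlinarith [sq_nonneg (v 1), sq_nonneg (v 0 + 1)]
    refine ⟨![v 0 + 2, v 1], ⟨![Real.sqrt (v 0 + 2), v 1], ⟨Real.sqrt_nonneg _, ?_⟩, ?_⟩, ?_⟩
    · show (Real.sqrt (v 0 + 2) ^ 2 - 2) ^ 2 + v 1 ^ 2 ≤ 1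
      rw [Real.sq_sqrt h0]; ring_nf; ring_nf at hv; linarith
    · ext j
      fin_cases j
      · simp [Real.sq_sqrt h0]
      · simp
    · ext j
      fin_cases j
      · simp
      · simp
  · rintro ⟨w, ⟨y, hy, rfl⟩, rfl⟩
    rw [mem_piDisc, soloInformedDiscShift_apply_zero, soloInformedDiscShift_apply_one,
      soloInformedFlatten_apply_zero, soloInformedFlatten_apply_one]
    exact hy.2

/-- Rule (2) for `τ`: `[Λ K₀, 1] − [D̄, 1] ∈ relations`. -/
theorem soloInformed_flatRep_section_sub_piRep_mem_relations :
    of (soloInformedFlatRep soloInformedTorusSection isCompact_soloInformedTorusSectionDom) - of piRep ∈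
      relations := by
  refine changeOfVariablesRel_subset_relations ⟨2,
    soloInformedFlatRep soloInformedTorusSection isCompact_soloInformedTorusSectionDom, piRep,
    soloInformedDiscShift, soloInformedJacCLM soloInformedDiscShiftPoly,
    isSemialgebraicMapOn_aeval (soloInformedFlatRep soloInformedTorusSection
      isCompact_soloInformedTorusSectionDom).isSemialgebraic_domain soloInformedDiscShiftPoly,
    fun u _ => (soloInformed_hasFDerivAt_polyMap soloInformedDiscShiftPoly u).hasFDerivWithinAt,
    ?_, soloInformed_piDisc_eq_shift_image, fun u _ => ?_, rfl⟩
  · intro u _ v _ huv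
    have e0 : u 0 - 2 = v 0 - 2 := by simpa using congr_fun huv 0
    have e1 : u 1 = v 1 := by simpa using congr_fun huv 1
    ext j
    fin_cases j
    · show u 0 = v 0
      linarith
    · exact e1
  · show (1 : ℝ) = 1 * |(soloInformedJacCLM soloInformedDiscShiftPoly u).det|
    rw [soloInformed_det_discShift, abs_one, mul_one]

/-- **The solid torus is `[D̄]·[D̄]` in the calculus** (unconditional): `[T₀, 1] − [D̄]·[D̄] ∈
relations`, by Pappus inside the calculus (`SoloInformedPappus`) and the translation `τ`.
[Kontsevich–Zagier 2001, §1.2 (rules); Pappus' centroid theorem] -/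
theorem soloInformed_torusRep_sub_piRep_mul_piRep_mem_relations :
    of soloInformedTorusRep - of piRep * of piRep ∈ relations := by
  have h1 := soloInformed_revRep_equivalent_piRep_prod_flatRep soloInformedTorusSection
    isCompact_soloInformedTorusSectionDom soloInformedTorusSection_subset
  have h3 : of piRep * (of (soloInformedFlatRep soloInformedTorusSection
      isCompact_soloInformedTorusSectionDom) - of piRep) ∈ relations :=
    mul_mem_relations_left_holds _ _ soloInformed_flatRep_section_sub_piRep_mem_relations
  have e : of soloInformedTorusRep - of piRep * of piRep =
      (of soloInformedTorusRep - of (piRep.prod (soloInformedFlatRep soloInformedTorusSection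
        isCompact_soloInformedTorusSectionDom))) +
      of piRep * (of (soloInformedFlatRep soloInformedTorusSection
        isCompact_soloInformedTorusSectionDom) - of piRep) := by
    rw [← of_mul_of, mul_sub]; abel
  rw [e]
  exact relations.add_mem h1 h3

/-- `vol T₀ = π²`. -/
theorem soloInformed_value_torusRep : soloInformedTorusRep.value = Real.pi ^ 2 := by
  rw [soloInformedTorusRep, soloInformed_value_revRep _ _ soloInformedTorusSection_subset,
    Equivalent.value_eq_holds soloInformed_flatRep_section_sub_piRep_mem_relations, piRep_value, sq]

/-! ### What volume rung 3 asserts about the instance -/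

/-- **The Theorem II instance, kernel part.** Granting `SoloInformedVolumeRung 3`, a relation
`p · π² = q · (log 2 · log 3)` with `p, q ≥ 1` forces `p · [D̄]·[D̄] − q · [L₂]·[L₃] ∈ relations`:
the dilates `Φ_p T₀` and `Φ_q B(2,3)` are compact solids with non-empty interior and equal volume,
hence move-equivalent by the rung, and `[Φ_p T₀] ∼ p·[T₀] ∼ p·[D̄]·[D̄]`, `[Φ_q B(2,3)] ∼ q·[B(2,3)]
∼ q·[L₂]·[L₃]` unconditionally. (The formal period ring admits no such relation — paper §3, PAPER —
so `Rung_3 ⇒ π² ∉ ℚ_{>0}·log 2·log 3`, an open case of the weak four-exponentials conjecture.) -/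
theorem soloInformed_rung_three_torus_box (h3 : SoloInformedVolumeRung 3) (p q : ℕ) (hp : p ≠ 0)
    (hq : q ≠ 0) (hrel : (p : ℝ) * Real.pi ^ 2 = q * (Real.log 2 * Real.log 3)) :
    p • (of piRep * of piRep) -
      q • (of (soloInformedKummerRep 2) * of (soloInformedKummerRep 3)) ∈ relations := by
  have hB := soloInformed_kummerBoxRep_isVolume 2 3 le_rfl (by norm_num)
  have hT1 : ∀ x ∈ soloInformedTorusRep.domain, soloInformedTorusRep.integrand x = 1 := fun _ _ => rfl
  have hS := soloInformed_stretchRep_sub_nsmul_mem_relations soloInformedTorusRep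
    isCompact_soloInformedTorusRep_domain hT1 p hp
  have hS' := soloInformed_stretchRep_sub_nsmul_mem_relations (soloInformedKummerBoxRep 2 3) hB.1
    hB.2.2 q hq
  have hv : (soloInformedStretchRep soloInformedTorusRep isCompact_soloInformedTorusRep_domain p).value
      = (soloInformedStretchRep (soloInformedKummerBoxRep 2 3) hB.1 q).value := by
    rw [soloInformed_value_stretchRep _ _ hT1 p hp, soloInformed_value_stretchRep _ _ hB.2.2 q hq,
      soloInformed_value_torusRep, soloInformed_value_kummerBoxRep 2 3 (by norm_num) (by norm_num)]
    exact_mod_cast hrel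
  have hE := h3 _ _ (isCompact_soloInformedStretchRep_domain _ _ p)
    (soloInformed_interior_stretchRep_nonempty _ _ p hp soloInformed_interior_torusRep_nonempty)
    (isCompact_soloInformedStretchRep_domain _ _ q)
    (soloInformed_interior_stretchRep_nonempty _ _ q hq hB.2.1) (fun _ _ => rfl) (fun _ _ => rfl) hv
  have hT := soloInformed_torusRep_sub_piRep_mul_piRep_mem_relations
  have hK := soloInformed_of_kummerBox_sub_mul_mem_relations 2 3
  have e : p • (of piRep * of piRep) -
      q • (of (soloInformedKummerRep 2) * of (soloInformedKummerRep 3)) =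
      -(p • (of soloInformedTorusRep - of piRep * of piRep)) -
      (of (soloInformedStretchRep soloInformedTorusRep isCompact_soloInformedTorusRep_domain p) -
        p • of soloInformedTorusRep) +
      (of (soloInformedStretchRep soloInformedTorusRep isCompact_soloInformedTorusRep_domain p) -
        of (soloInformedStretchRep (soloInformedKummerBoxRep 2 3) hB.1 q)) +
      (of (soloInformedStretchRep (soloInformedKummerBoxRep 2 3) hB.1 q) -
        q • of (soloInformedKummerBoxRep 2 3)) +
      q • (of (soloInformedKummerBoxRep 2 3) -
        of (soloInformedKummerRep 2) * of (soloInformedKummerRep 3)) := by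
    rw [nsmul_sub, nsmul_sub]; abel
  rw [e]
  exact relations.add_mem (relations.add_mem (relations.add_mem (relations.sub_mem
    (relations.neg_mem (relations.nsmul_mem hT p)) hS) hE) hS') (relations.nsmul_mem hK q)

end Summit.KontsevichZagierPeriods.KontsevichZagierPeriods.Theorems
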